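import Mathlib.FieldTheory.Finite.Basic
import Mathlib.NumberTheory.LegendreSymbol.ZModChar
import Mathlib.NumberTheory.LegendreSymbol.QuadraticChar.Basic
import Literature.NumberTheory.QuadraticForms.HilbertSymbolLocal
import Literature.NumberTheory.QuadraticForms.HilbertReciprocityFiniteness
import Literature.RingTheory.DiscreteValuationRing.AdicCompletionResidueField
import HarnessLib

/-!
# The Hilbert symbol `(x, -1)_v` at a non-dyadic place: the quadratic character modulo `4`

Topic `NumberTheory/QuadraticForms`; namespace `Literature.NumberTheory.QuadraticForms`; all
declarations fully proved. For a number field `K`, a finite place `v` not above `2` and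
`x ∈ K_vˣ`:

* `hilbertSymbol_neg_one_eq_one_of_even` : if `v(x)` is even then `(x, -1)_v = 1`
  (`x = u c²` with `u` a `v`-unit, and `(u, -1)_v = 1` for units at a non-dyadic place,
  O'Meara Example 63:12);
* `hilbertSymbol_neg_one_of_odd` : if `v(x)` is odd then `(x, -1)_v = χ₄(N v)`, where
  `N v = |𝓞 K / v|` and `χ₄` is the non-trivial character modulo `4` (Mathlib `ZMod.χ₄`): indeed
  `(x, -1)_v = (u ϖ, -1)_v` is `-1` iff `-1` is a non-square in the residue field `𝓀_v`
  (O'Meara 63:11a, Example 63:12, Hensel), iff `N v ≡ 3 (mod 4)` (Mathlib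
  `FiniteField.isSquare_neg_one_iff`; `𝓀_v ≅ 𝓞 K / v`,
  `IsDedekindDomain.HeightOneSpectrum.residueFieldEquiv` of
  `Literature/RingTheory/DiscreteValuationRing/AdicCompletionResidueField.lean`);
* `hilbertSymbol_neg_one_eq_χ₄_pow` : for `x ∈ 𝓞 K`, `x ≠ 0`:
  `(x, -1)_v = χ₄(N v) ^ ord_v(x)` with `ord_v(x)` the exponent of `v` in `(x)`.

This is the local computation behind O'Meara's Formula 71:10 for `β = -1` (the Frobenius of
`F(√-1)/F` at `𝔭` acts on `√-1` by `(α, -1)_𝔭`), used in the proof of 71:13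
(`HilbertSymbolNegOneReciprocity.lean`).

## References

* O. T. O'Meara, *Introduction to quadratic forms*, Grundlehren 117, Springer (1963), §63B
  (63:11a, Example 63:12), §71B (Formula 71:10).
* K. Ireland, M. Rosen, *A classical introduction to modern number theory*, GTM 84 (1990),
  Ch. 5 §1 (`-1` is a square mod `p` iff `p ≡ 1 (mod 4)`), for comparison.
-/

noncomputable section

open NumberField IsDedekindDomain Valued

namespace Literature.NumberTheory.QuadraticForms

variable (K : Type*) [Field K] [NumberField K] (v : HeightOneSpectrum (𝓞 K))

/-! ### The residue field: cardinality and `-1` -/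

/-- `|𝓀_v| = N v = |𝓞 K / v|` (`Ideal.absNorm`), through
`IsDedekindDomain.HeightOneSpectrum.residueFieldEquiv`. [folklore] -/
theorem natCard_residueField_eq_absNorm :
    Nat.card 𝓀[v.adicCompletion K] = Ideal.absNorm v.asIdeal := by
  rw [HeightOneSpectrum.natCard_residueField_adicCompletion K v, Ideal.absNorm_apply,
    Submodule.cardQuot_apply]

/-- At a place `v` not above `2`, `N v` is odd. [folklore] -/
theorem absNorm_odd_of_not_mem (h2 : (2 : 𝓞 K) ∉ v.asIdeal) : Odd (Ideal.absNorm v.asIdeal) := by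
  classical
  haveI := Literature.NumberTheory.Automorphic.finite_residueField_adicCompletion K v
  letI := Fintype.ofFinite 𝓀[v.adicCompletion K]
  rw [← natCard_residueField_eq_absNorm, Nat.card_eq_fintype_card, Nat.odd_iff]
  exact FiniteField.odd_card_of_char_ne_two
    (ringChar_residueField_ne_two K v (isUnit_two_integer_of_not_mem K v h2))

/-- `-1` is a square in the residue field `𝓀_v` iff `N v ≢ 3 (mod 4)` (Mathlib
`FiniteField.isSquare_neg_one_iff`; in characteristic `2` both sides hold). [folklore] -/
theorem isSquare_neg_one_residueField_iff :
    IsSquare (-1 : 𝓀[v.adicCompletion K]) ↔ Ideal.absNorm v.asIdeal % 4 ≠ 3 := by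
  classical
  haveI := Literature.NumberTheory.Automorphic.finite_residueField_adicCompletion K v
  letI := Fintype.ofFinite 𝓀[v.adicCompletion K]
  rw [FiniteField.isSquare_neg_one_iff, ← Nat.card_eq_fintype_card, natCard_residueField_eq_absNorm]

/-! ### `(x, -1)_v` for `x` of even and of odd valuation -/

variable {K v}

/-- Units pair trivially with `-1` at a non-dyadic place: `(u, -1)_v = 1` for `v(u) = 0`
(O'Meara Example 63:12). [cite: Omeara1963, §63B Example 63:12] -/
theorem hilbertSymbol_neg_one_eq_one_of_valuation_eq_one (h2 : (2 : 𝓞 K) ∉ v.asIdeal)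
    {u : v.adicCompletion K} (hu : Valued.v u = 1) :
    hilbertSymbol (v.adicCompletion K) u (-1) = 1 := by
  have hU : IsUnit (⟨u, hu.le⟩ : 𝒪[v.adicCompletion K]) := (isUnit_integer_iff K v _).2 hu
  have h1 : IsUnit (-1 : 𝒪[v.adicCompletion K]) := isUnit_one.neg
  have := hilbertSymbol_eq_one_of_isUnit K v (isUnit_two_integer_of_not_mem K v h2) hU h1
  simpa using this

/-- A uniformiser of `K_v` coming from `K`: `v(ϖ) = exp(-1)`. [folklore] -/
theorem exists_valued_eq_exp_neg_one :
    ∃ ϖ : v.adicCompletion K, Valued.v ϖ = WithZero.exp (-1 : ℤ) := by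
  obtain ⟨π, hπ⟩ := HeightOneSpectrum.valuation_exists_uniformizer K v
  have hval : Valued.v (algebraMap K (v.adicCompletion K) π) = v.valuation K π :=
    HeightOneSpectrum.valuedAdicCompletion_eq_valuation' v π
  exact ⟨algebraMap K _ π, by rw [hval, hπ]⟩

/-- **Even valuation**: if `v ∤ 2` and `v(x)` is even (`x ≠ 0`) then `(x, -1)_v = 1` — write
`x = u ϖ^{2j}` with `u` a unit; the square factor drops out and `(u, -1)_v = 1`.
[cite: Omeara1963, §63B Example 63:12] -/
theorem hilbertSymbol_neg_one_eq_one_of_even (h2 : (2 : 𝓞 K) ∉ v.asIdeal)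
    {x : v.adicCompletion K} (hx : x ≠ 0) (heven : Even (WithZero.log (Valued.v x))) :
    hilbertSymbol (v.adicCompletion K) x (-1) = 1 := by
  obtain ⟨ϖ, hϖ⟩ := exists_valued_eq_exp_neg_one (K := K) (v := v)
  have hϖ0 : ϖ ≠ 0 := fun h ↦ by
    rw [h, map_zero] at hϖ
    exact WithZero.coe_ne_zero hϖ.symm
  obtain ⟨j, hj⟩ := heven
  -- `v(x) = exp (j + j)`, so `u := x * ϖ ^ (j + j)` is a unit
  set u : v.adicCompletion K := x * ϖ ^ (j + j) with hu_def
  have hvx0 : Valued.v x ≠ 0 := (Valuation.ne_zero_iff _).2 hx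
  have hvx : Valued.v x = WithZero.exp (j + j) := by
    rw [← WithZero.exp_log hvx0, hj]
  have hu : Valued.v u = 1 := by
    rw [hu_def, map_mul, map_zpow₀, hvx, hϖ, ← WithZero.exp_zsmul, ← WithZero.exp_add]
    convert WithZero.exp_zero using 2
    simp only [smul_eq_mul, mul_neg, mul_one]
    abel
  have hxu : x = u * (ϖ ^ (-j)) ^ 2 := by
    rw [hu_def, mul_assoc, ← zpow_natCast, ← zpow_mul, ← zpow_add₀ hϖ0]
    norm_num
    rw [show j + j + -(j * 2) = 0 by ring, zpow_zero, mul_one]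
  rw [hxu, hilbertSymbol_mul_sq_left _ _ (zpow_ne_zero _ hϖ0)]
  exact hilbertSymbol_neg_one_eq_one_of_valuation_eq_one h2 hu

/-- **Odd valuation**: if `v ∤ 2` and `v(x)` is odd then `(x, -1)_v = χ₄(N v)`: it is `-1` iff
`-1` is a non-square in `𝓀_v` (tame symbol, O'Meara 63:11a / Example 63:12, and Hensel's lemma
for the converse), iff `N v ≡ 3 (mod 4)`. [cite: Omeara1963, §63B Cor. 63:11a and Example 63:12] -/
theorem hilbertSymbol_neg_one_of_odd (h2 : (2 : 𝓞 K) ∉ v.asIdeal) {x : v.adicCompletion K}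
    (hodd : Odd (WithZero.log (Valued.v x))) :
    hilbertSymbol (v.adicCompletion K) x (-1) = ZMod.χ₄ (Ideal.absNorm v.asIdeal) := by
  haveI := Literature.NumberTheory.Automorphic.finite_residueField_adicCompletion K v
  have h2u := isUnit_two_integer_of_not_mem K v h2
  rw [hilbertSymbol_comm]
  by_cases hsq : IsSquare (-1 : 𝓀[v.adicCompletion K])
  · -- `-1` is a square in `𝓀_v`, hence in `𝒪_v` (Hensel): the symbol is `1`, and `N v ≡ 1 (4)`
    have h1 : IsUnit (-1 : 𝒪[v.adicCompletion K]) := isUnit_one.neg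
    have hsq' : IsSquare (-1 : 𝒪[v.adicCompletion K]) :=
      isSquare_of_isSquare_residue K v h2u h1 (by simpa using hsq)
    have hsqK : IsSquare (-1 : v.adicCompletion K) := by
      simpa using hsq'.map (algebraMap _ (v.adicCompletion K))
    rw [hilbertSymbol_eq_one_of_isSquare hsqK (neg_ne_zero.2 one_ne_zero)]
    have hmod : Ideal.absNorm v.asIdeal % 4 = 1 := by
      have h3 := (isSquare_neg_one_residueField_iff K v).1 hsq
      have hodd' := absNorm_odd_of_not_mem K v h2
      rw [Nat.odd_iff] at hodd'
      omega
    rw [ZMod.χ₄_nat_one_mod_four hmod]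
  · have hneg : hilbertSymbol (v.adicCompletion K) (-1) x = -1 := by
      have := hilbertSymbol_eq_neg_one_of_not_isSquare_residue_of_odd K v
        (ε := (-1 : 𝒪[v.adicCompletion K])) (by simpa using hsq) hodd
      simpa using this
    rw [hneg]
    have hmod : Ideal.absNorm v.asIdeal % 4 = 3 := by
      have h3 := (isSquare_neg_one_residueField_iff K v).not.1 hsq
      push Not at h3
      exact h3
    rw [ZMod.χ₄_nat_three_mod_four hmod]

/-- `χ₄(N v) = ±1` at a non-dyadic place (`N v` odd), so `χ₄(N v) ^ n` only depends on the parity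
of `n`. [folklore] -/
theorem χ₄_absNorm_sq (h2 : (2 : 𝓞 K) ∉ v.asIdeal) :
    (ZMod.χ₄ (Ideal.absNorm v.asIdeal : ℕ)) ^ 2 = 1 := by
  have hodd := absNorm_odd_of_not_mem K v h2
  rw [Nat.odd_iff] at hodd
  have h : Ideal.absNorm v.asIdeal % 4 = 1 ∨ Ideal.absNorm v.asIdeal % 4 = 3 := by omega
  rcases h with h | h
  · rw [ZMod.χ₄_nat_one_mod_four h, one_pow]
  · rw [ZMod.χ₄_nat_three_mod_four h]; norm_num

/-! ### Integral elements: `(x, -1)_v = χ₄(N v) ^ ord_v(x)` -/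

/-- For `x ∈ 𝓞 K`, `x ≠ 0`, the `ℤᵐ⁰`-logarithm of `v(x)` in `K_v` is `-ord_v(x)`, the exponent of
`v` in the factorisation of `(x)` (Mathlib `intValuation_if_neg`). [folklore] -/
theorem log_valued_algebraMap (x : 𝓞 K) (hx : x ≠ 0) :
    WithZero.log (Valued.v (algebraMap K (v.adicCompletion K) (x : K))) =
      -((Associates.mk v.asIdeal).count (Associates.mk (Ideal.span {x})).factors : ℤ) := by
  have hval : Valued.v (algebraMap K (v.adicCompletion K) (x : K)) = v.valuation K (x : K) :=
    HeightOneSpectrum.valuedAdicCompletion_eq_valuation' v (x : K)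
  rw [hval, show (x : K) = algebraMap (𝓞 K) K x from rfl, HeightOneSpectrum.valuation_of_algebraMap,
    HeightOneSpectrum.intValuation_if_neg _ hx, WithZero.log_exp]

/-- **`(x, -1)_v = χ₄(N v) ^ ord_v(x)`** for `x ∈ 𝓞 K ∖ {0}` at a place `v ∤ 2` (even exponent:
`hilbertSymbol_neg_one_eq_one_of_even`; odd exponent: `hilbertSymbol_neg_one_of_odd`). This is
O'Meara's Formula 71:10 for `β = -1` made explicit: the Frobenius of `K(√-1)/K` at `v` raised to
`ord_v(x)`. [cite: Omeara1963, §71B Formula 71:10 (case β = -1), with §63B Example 63:12] -/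
theorem hilbertSymbol_neg_one_eq_χ₄_pow (h2 : (2 : 𝓞 K) ∉ v.asIdeal) (x : 𝓞 K) (hx : x ≠ 0) :
    hilbertSymbol (v.adicCompletion K) (algebraMap K _ (x : K)) (-1) =
      (ZMod.χ₄ (Ideal.absNorm v.asIdeal : ℕ)) ^
        (Associates.mk v.asIdeal).count (Associates.mk (Ideal.span {x})).factors := by
  set n := (Associates.mk v.asIdeal).count (Associates.mk (Ideal.span {x})).factors with hn
  have hlog := log_valued_algebraMap (K := K) (v := v) x hx
  have hx' : algebraMap K (v.adicCompletion K) (x : K) ≠ 0 :=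
    (map_ne_zero _).2 (RingOfIntegers.coe_ne_zero_iff.2 hx)
  rcases Nat.even_or_odd n with ⟨m, hm⟩ | ⟨m, hm⟩
  · rw [hilbertSymbol_neg_one_eq_one_of_even h2 hx' (by rw [hlog, ← hn, hm]; exact ⟨-m, by omega⟩),
      hm, ← two_mul, pow_mul, χ₄_absNorm_sq h2, one_pow]
  · rw [hilbertSymbol_neg_one_of_odd h2 (by rw [hlog, ← hn, hm]; exact ⟨-(m + 1), by omega⟩), hm,
      pow_succ, pow_mul, χ₄_absNorm_sq h2, one_pow, one_mul]

end Literature.NumberTheory.QuadraticForms
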